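/-
Copyright (c) 2026. All rights reserved.
Released under Apache 2.0 license as described in the file LICENSE.
Authors: abc-iut cell, fact-proving seat abc-iut-f-102 (block F, tranche 102).
-/
import Mathlib.Algebra.Category.Grp.Preadditive
import Mathlib.CategoryTheory.Preadditive.FunctorCategory
import Literature.AnabelianGeometry.AbsoluteAnabelian.LogFrobeniusCoresProofs
import Literature.AnabelianGeometry.AbsoluteAnabelian.LogFrobeniusRigidityProofs
import HarnessLib

/-!
# [AbsTopIII] Corollary 5.5 (i)/(iii)/(v) realised in ONE family of homotopies: the pre-log `ι⊞_{v,ε}` become ISOMORPHISMS over `ℰ•` (a necessary condition for FACT-LIST rows F-0157 / F-0159, and their refutation over NONEMPTY index sets)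

S. Mochizuki, *Topics in absolute anabelian geometry III: global reconstruction algorithms*,
J. Math. Sci. Univ. Tokyo 22 (2015) 939–1156 [MochizukiAbsTopIII2015]; locators `p.N` = pages of the
author's manuscript (`paper:url-5493eb38cbb7`): Def 3.5 (ii), (iii) pp. 75–76 (families of homotopies: functoriality and
whiskering of the `ζ_ϖ`; observables; cores — "every `ζ_ϖ` of a core is an isomorphism"), Def 5.4 (iv), (vii) pp. 126–128
(`λ⊞_{v,ν}` lies over `Th•[Z]`; `ι⊞_{v,ε}`), Cor 5.5 (i) p. 130, (iii) p. 131 ("compatible with … the core and telecore structures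
of (i), (ii)"), (v) pp. 131–132.

PROOF-ONLY companion (no `def`, nothing restated) of `LogFrobeniusRigidity.lean` (abc-iut-L4-t3: `RealisesCor55Families` =
F-0159, `Cor55ShiftAction` = F-0157, `Cor55Rigidity` = F-0156) and abc-iut-w5-d112's `cor55ShiftAction_iff`.  For EVERY
setting `L` and every family `K` on `D•⊢`:

* `isIso_toE_forget_iota_of_realisesCor55Families` — if `K` realises the core `ℰ•` of `D•_{≤5}` on `D•_{≤4}` (Cor 5.5 (i))
  AND the observable `S_log⊞_v` (Cor 5.5 (iii)) — `RealisesCor55Families K` — then for every arrow `ε : ν₁ → ν₂` of `Γ⃗^⋉_v`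
  between PRE-LOG vertices the natural transformation `ι⊞_{v,ε} : λ⊞_{v,ν₁} → λ⊞_{v,ν₂}` becomes an ISOMORPHISM after
  `𝒩⊞_v → 𝒩_v → ℰ•`.  Mechanism (Def 3.5 (ii)–(iii) only): the pair `([λ⊞_{ν₁}], [λ⊞_{ν₂}])` is a boundary pair of `S_log⊞_v`
  with homotopy `ι⊞_{v,ε}`; its image in `K`, post-composed with `𝒩⊞_v → 𝒩_v → ℰ•` (whiskering axiom), is the image of a
  boundary pair of the CORE, whose homotopies are all invertible; one family has ONE homotopy per pair.  In print this is
  automatic ("`λ⊞_{v,ν}` … lie over `Th•[Z]`", Def 5.4 (iv): over `ℰ• = Th•[Z]` every `ι⊞` is the identity), but the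
  interface `LogFrobeniusSetting` does not record it — so it is a genuine CONDITION on `L`:
* `exists_forall_not_realisesCor55Families` — over every index set with an element `v₀` (so also for number-field-like,
  NONEMPTY `V(F_mod)`) there is a setting at which NO family realises Cor 5.5 (i)/(iii), hence `Cor55ShiftAction` and
  `Cor55Rigidity` fail: the ZERO-TWISTED diagonal setting on `AddCommGrpCat` (every `ι⊞_{v,ε} := 0`; cf. abc-iut-w4-d095's
  `LogFrobeniusLogWallNonVacuity.lean`), where `0 : ℤ → ℤ` is not invertible.  With `LogFrobeniusShiftActionNecessity.lean`
  (empty index set) and the diagonal instance (sequel file) this settles the kernel status of F-0157 / F-0159: conditions on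
  the setting, independent of the interface, consumable at NAMED instances only (R5).

HONEST LABEL: a necessary condition on, and a degenerate counter-setting for, TYPED statements; print's genuine data satisfy
the condition by Def 5.4 (iv); nothing about print is impugned.  Refereed pre-IUT anabelian geometry; nothing here bears on
[IUTchIII] Cor. 3.12; typed ≠ proved.
-/

set_option autoImplicit false

universe u

open CategoryTheory Quiver

namespace Literature.AnabelianGeometry.AbsoluteAnabelian

/-! ## Bookkeeping: isomorphy and components under heterogeneous equality -/

section HEqLemmas

variable {A : Type*} [Category A] {B : Type*} [Category B]

/-- An invertible natural transformation stays invertible along equalities of its source and target functors. [folklore] -/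
private theorem isIso_of_heq {F G F' G' : A ⥤ B} (hF : F = F') (hG : G = G') {α : F ⟶ G} {β : F' ⟶ G'}
    (h : HEq α β) (hα : IsIso α) : IsIso β := by
  subst hF hG
  cases h
  exact hα

/-- Components along equalities of the source and target functors differ by `eqToHom`s. [folklore] -/
private theorem app_eq_of_heq {F G F' G' : A ⥤ B} (hF : F = F') (hG : G = G') {α : F ⟶ G} {β : F' ⟶ G'}
    (h : HEq α β) (x : A) :
    β.app x = eqToHom (by rw [hF]) ≫ α.app x ≫ eqToHom (by rw [hG]) := by
  subst hF hG
  cases h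
  simp

/-- The middle factor of an invertible composite with invertible outer factors is invertible. [folklore] -/
private theorem isIso_of_isIso_comp₃ {w x y z : B} (f : w ⟶ x) (g : x ⟶ y) (h : y ⟶ z) [IsIso f] [IsIso h]
    (H : IsIso (f ≫ g ≫ h)) : IsIso g := by
  haveI : IsIso (g ≫ h) := IsIso.of_isIso_comp_left f (g ≫ h)
  exact IsIso.of_isIso_comp_right g h

/-- Transport of isomorphy of `G(α_y)` along an equality of points `y = x`. [folklore] -/
private theorem isIso_map_app_congr {C : Type*} [Category C] (G : B ⥤ C) {F₁ F₂ : A ⥤ B} (α : F₁ ⟶ F₂) {y x : A}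
    (hyx : y = x) (H : IsIso (G.map (α.app y))) : IsIso (G.map (α.app x)) := by
  subst hyx
  exact H

/-- Transport of isomorphy of `G(f)` along an equality of functors `G = G'`. [folklore] -/
private theorem isIso_map_congr {C : Type*} [Category C] {G G' : B ⥤ C} (hG : G = G') {x y : B} (f : x ⟶ y)
    (H : IsIso (G.map f)) : IsIso (G'.map f) := by
  subst hG
  exact H

end HEqLemmas

/-- Every `Γ⃗^⋉_v` has an arrow between two PRE-LOG vertices: the shell-arrow `k~ ↠ k^×` (archimedean), `𝒪^× ↪ k̄^×`
(nonarchimedean). [cite: MochizukiAbsTopIII2015, Def 5.4 (iii) p. 126] -/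
theorem LogVertex.exists_preLog_edge (b : Bool) : ∃ (ν₁ ν₂ : LogVertex b) (_ : LogEdge b ν₁ ν₂),
    ν₁.isPostLog = false ∧ ν₂.isPostLog = false := by
  cases b
  · exact ⟨NonarchVertex.units, NonarchVertex.mult, ⟨NonarchEdge.unitsToMult, trivial⟩, rfl, rfl⟩
  · exact ⟨ArchVertex.pre, ArchVertex.mult, ArchEdge.shell, rfl, rfl⟩

namespace LogFrobeniusSetting

variable {Vmod : Type u} {isArc : Vmod → Bool} (L : LogFrobeniusSetting Vmod isArc)

/-- The homotopies of one family at (propositionally) equal pairs agree. [cite: MochizukiAbsTopIII2015, Definition 3.5 (ii) p.75] -/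
private theorem η_heq_of_eq (K : L.diagram.HomotopyFamily) {a b : DVertex Vmod isArc} {p p' q q' : Path a b}
    (hp : p = p') (hq : q = q') (h : K.E p q) (h' : K.E p' q') : HEq (K.η h) (K.η h') := by
  subst hp hq
  rfl

/-! ## The core side: the pair `([toE]∘[forget]∘[λ⊞_{ν₁}], [toE]∘[forget]∘[λ⊞_{ν₂}])` has an invertible homotopy in `K` -/

/-- If `K` contains the core `ℰ•` of `D•_{≤5}` on `D•_{≤4}` (Cor 5.5 (i), `IsCoreOnIn`), then the co-verticial pair of paths
`□ → 𝒩⊞_v → 𝒩_v → ℰ•` through `λ⊞_{v,ν₁}`, `λ⊞_{v,ν₂}` is a boundary pair of `K` with INVERTIBLE homotopy (a core is symmetric,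
Def 3.5 (iii)). [cite: MochizukiAbsTopIII2015, Definition 3.5 (iii) pp. 75–76] -/
theorem exists_isIso_η_corePair {K : L.diagram.HomotopyFamily} (hcore : L.IsCoreOnIn K (DVertex.InFirstRows 4) .e5)
    (v : Vmod) (ν₁ ν₂ : LogVertex (isArc v)) (h₁ : ν₁.isPostLog = false) (h₂ : ν₂.isPostLog = false) :
    ∃ k : K.E
      (((Path.nil.cons (DEdge.lam v ν₁ h₁ : DVertex.core ⟶ DVertex.nplus v)).cons
        (DEdge.forget v : DVertex.nplus v ⟶ DVertex.nv v)).cons (DEdge.toE v : DVertex.nv v ⟶ DVertex.e5))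
      (((Path.nil.cons (DEdge.lam v ν₂ h₂ : DVertex.core ⟶ DVertex.nplus v)).cons
        (DEdge.forget v : DVertex.nplus v ⟶ DVertex.nv v)).cons (DEdge.toE v : DVertex.nv v ⟶ DVertex.e5)),
      IsIso (K.η k) := by
  obtain ⟨He, hHe, hc, hcomp⟩ := hcore
  have hc4 : DVertex.InFirstRows (Vmod := Vmod) (isArc := isArc) 4 .core := ⟨trivial, by simp [DVertex.row]⟩
  have hnp4 : DVertex.InFirstRows (Vmod := Vmod) (isArc := isArc) 4 (.nplus v) := ⟨trivial, by simp [DVertex.row]⟩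
  have hnv4 : DVertex.InFirstRows (Vmod := Vmod) (isArc := isArc) 4 (.nv v) := ⟨trivial, by simp [DVertex.row]⟩
  let X4 := obsShape (DVertex.InFirstRows (Vmod := Vmod) (isArc := isArc) 4) DVertex.e5
  let Q : (ν : LogVertex (isArc v)) → ν.isPostLog = false → Path (X4.base ⟨.core, hc4⟩) X4.obs := fun ν hν =>
    ((Path.nil.cons (show X4.base ⟨.core, hc4⟩ ⟶ X4.base ⟨.nplus v, hnp4⟩ from DEdge.lam v ν hν)).cons
      (show X4.base ⟨.nplus v, hnp4⟩ ⟶ X4.base ⟨.nv v, hnv4⟩ from DEdge.forget v)).cons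
      (show X4.base ⟨.nv v, hnv4⟩ ⟶ X4.obs from DEdge.toE v)
  have hQ : He.E (Q ν₁ h₁) (Q ν₂ h₂) := hc.boundary_all (Q ν₁ h₁) (Q ν₂ h₂)
  have hiso : IsIso (He.η hQ) :=
    DiagramOfCategories.HomotopyFamily.isIso_of_isSymmetric _ He
      (DiagramOfCategories.Observable.IsCore.isSymmetric _ hc) hQ
  obtain ⟨k, hk⟩ := hcomp (Q ν₁ h₁) (Q ν₂ h₂) hQ
  have hF : ∀ (ν : LogVertex (isArc v)) (hν : ν.isPostLog = false),
      ((L.subdiagram (DVertex.InFirstRows 4)).extend (L.obsExt (DVertex.InFirstRows 4) .e5)).pathFunctor (Q ν hν) =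
        L.diagram.pathFunctor ((embExt (DVertex.InFirstRows 4) .e5).mapPath (Q ν hν)) := by
    intro ν hν
    simp only [Q, DiagramOfCategories.pathFunctor_cons, DiagramOfCategories.pathFunctor_nil, Prefunctor.mapPath_cons,
      Prefunctor.mapPath_nil]
    rfl
  exact ⟨k, isIso_of_heq (hF ν₁ h₁) (hF ν₂ h₂) hk hiso⟩

/-! ## The observable side: the pair `([λ⊞_{ν₁}], [λ⊞_{ν₂}])` has homotopy `ι⊞_{v,ε}` in `K` -/

/-- If `K` contains the observable `S_log⊞_v` (Cor 5.5 (iii), `IsLogObservablePlus` embedded by `CompatibleIn`), then for an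
arrow `ε : ν₁ → ν₂` of `Γ⃗^⋉_v` between pre-log vertices the pair `([λ⊞_{ν₁}], [λ⊞_{ν₂}])` is a boundary pair of `K` whose
homotopy is `ι⊞_{v,ε}` componentwise. [cite: MochizukiAbsTopIII2015, Cor 5.5 (iii) p. 131] -/
theorem exists_η_obsPair_eq_iota {K : L.diagram.HomotopyFamily} (v : Vmod)
    (hobs : ∃ H : (L.logDiagramPlus v).HomotopyFamily, L.IsLogObservablePlus v H ∧ L.CompatibleIn K H)
    {ν₁ ν₂ : LogVertex (isArc v)} (ε : LogEdge (isArc v) ν₁ ν₂) (h₁ : ν₁.isPostLog = false)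
    (h₂ : ν₂.isPostLog = false) :
    ∃ k : K.E (Path.nil.cons (DEdge.lam v ν₁ h₁ : DVertex.core ⟶ DVertex.nplus v))
      (Path.nil.cons (DEdge.lam v ν₂ h₂ : DVertex.core ⟶ DVertex.nplus v)),
      ∀ X₀ : L.X,
        ∃ (e₁ : (L.diagram.pathFunctor (Path.nil.cons (DEdge.lam v ν₁ h₁ : DVertex.core ⟶ DVertex.nplus v))).obj X₀ =
            (frobeniusTwist L.log ν₁.isPostLog ⋙ L.lam v ν₁).obj X₀)
          (e₂ : (L.lam v ν₂).obj X₀ =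
            (L.diagram.pathFunctor (Path.nil.cons (DEdge.lam v ν₂ h₂ : DVertex.core ⟶ DVertex.nplus v))).obj X₀),
          (K.η k).app X₀ = eqToHom e₁ ≫ (L.iota v ε).app X₀ ≫ eqToHom e₂ := by
  obtain ⟨Hv, hHv, hcomp⟩ := hobs
  obtain ⟨hmem, hι⟩ := hHv.2.1 ν₁ ν₂ ε h₁ h₂
  obtain ⟨k, hk⟩ := hcomp (lamPath v ν₁ h₁) (lamPath v ν₂ h₂) hmem
  have hF : ∀ (ν : LogVertex (isArc v)) (hν : ν.isPostLog = false),
      (L.logDiagramPlus v).pathFunctor (lamPath v ν hν) =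
        L.diagram.pathFunctor (Path.nil.cons (DEdge.lam v ν hν : DVertex.core ⟶ DVertex.nplus v)) := by
    intro ν hν
    simp only [lamPath, DiagramOfCategories.pathFunctor_cons, DiagramOfCategories.pathFunctor_nil]
    rfl
  refine ⟨k, fun X₀ => ?_⟩
  obtain ⟨hobj, hobj', hη⟩ := hι X₀
  refine ⟨(Functor.congr_obj (hF ν₁ h₁) X₀).symm.trans hobj, hobj'.trans (Functor.congr_obj (hF ν₂ h₂) X₀), ?_⟩
  refine (app_eq_of_heq (hF ν₁ h₁) (hF ν₂ h₂) hk X₀).trans ?_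
  simp only [hη, Category.assoc, eqToHom_trans, eqToHom_trans_assoc]
  rfl

/-! ## The necessary condition -/

/-- **Inside one family of homotopies, a core `ℰ•` compatible with `S_log⊞_v` forces every pre-log `ι⊞_{v,ε}` to become an
isomorphism over `ℰ•`.**  If `K` realises Cor 5.5 (i)/(iii) (`RealisesCor55Families K`, F-0159), then for every
`v ∈ V(F_mod)`, every arrow `ε : ν₁ → ν₂` of `Γ⃗^⋉_v` between pre-log vertices and every object `X₀` of `𝒳`, the morphism
`(𝒩⊞_v → 𝒩_v → ℰ•)(ι⊞_{v,ε,X₀})` is invertible: by the whiskering axiom of Def 3.5 (ii) the post-composite of the `S_log⊞_v`-pair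
`([λ⊞_{ν₁}],[λ⊞_{ν₂}])` (homotopy `ι⊞_{v,ε}`) with `𝒩⊞_v → 𝒩_v → ℰ•` is a boundary pair of `K` with homotopy `ι⊞_{v,ε} ▹ (𝒩⊞_v → ℰ•)`,
and the same pair is a boundary pair of the CORE, where every homotopy is invertible (Def 3.5 (iii)).  In print the
conclusion holds because the `λ⊞_{v,ν}` lie over `Th•[Z]` (Def 5.4 (iv)); the interface does not record this, so it is a
condition on `L`. [cite: MochizukiAbsTopIII2015, Cor 5.5 (iii) p. 131] -/
theorem isIso_toE_forget_iota_of_realisesCor55Families {K : L.diagram.HomotopyFamily} (hK : L.RealisesCor55Families K)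
    (v : Vmod) {ν₁ ν₂ : LogVertex (isArc v)} (ε : LogEdge (isArc v) ν₁ ν₂) (h₁ : ν₁.isPostLog = false)
    (h₂ : ν₂.isPostLog = false) (X₀ : L.X) :
    IsIso ((L.toE v).map ((L.forget v).map ((L.iota v ε).app X₀))) := by
  obtain ⟨k, hk⟩ := L.exists_isIso_η_corePair hK.1 v ν₁ ν₂ h₁ h₂
  obtain ⟨k₁, hk₁⟩ := L.exists_η_obsPair_eq_iota v (hK.2.2.2 v) ε h₁ h₂
  -- post-compose the observable pair with `𝒩⊞_v → 𝒩_v → ℰ•` (whiskering axiom, Def 3.5 (ii))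
  let r : Path (DVertex.nplus v : DVertex Vmod isArc) DVertex.e5 :=
    (Path.nil.cons (DEdge.forget v : DVertex.nplus v ⟶ DVertex.nv v)).cons (DEdge.toE v : DVertex.nv v ⟶ DVertex.e5)
  have hw := K.η_whisker k₁ Path.nil r
  -- the whiskered pair IS the core pair (up to `[] ∘ γ = γ`), so its homotopy is invertible
  have hiso₂ : IsIso (K.η (K.isSaturated.precomp (K.isSaturated.postcomp k₁ r) Path.nil)) :=
    isIso_of_heq (congrArg L.diagram.pathFunctor (Path.nil_comp _).symm)
      (congrArg L.diagram.pathFunctor (Path.nil_comp _).symm)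
      (L.η_heq_of_eq K (Path.nil_comp _).symm (Path.nil_comp _).symm k _) hk
  rw [hw] at hiso₂
  have hW := isIso_of_isIso_comp₃ _ _ _ hiso₂
  -- evaluate at `X₀` (seen in `𝒟_□` through the empty path)
  have h3 : IsIso ((L.diagram.pathFunctor r).map ((K.η k₁).app
      ((L.diagram.pathFunctor (Path.nil : Path (DVertex.core : DVertex Vmod isArc) .core)).obj X₀))) := by
    haveI := hW
    exact (inferInstance : IsIso ((Functor.whiskerLeft (L.diagram.pathFunctor Path.nil)
      (Functor.whiskerRight (K.η k₁) (L.diagram.pathFunctor r))).app X₀))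
  obtain ⟨e₁, e₂, hY⟩ :=
    hk₁ ((L.diagram.pathFunctor (Path.nil : Path (DVertex.core : DVertex Vmod isArc) .core)).obj X₀)
  rw [hY] at h3
  simp only [Functor.map_comp] at h3
  have h4 := isIso_of_isIso_comp₃ _ _ _ h3
  -- `𝒟_[toE ∘ forget] = (𝒩⊞_v → 𝒩_v) ⋙ (𝒩_v → ℰ•)` and `𝒟_[]` is the identity
  have hr : L.diagram.pathFunctor r = (𝟭 _ ⋙ L.forget v) ⋙ L.toE v := by
    simp only [r, DiagramOfCategories.pathFunctor_cons, DiagramOfCategories.pathFunctor_nil]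
    rfl
  have h0 : (L.diagram.pathFunctor (Path.nil : Path (DVertex.core : DVertex Vmod isArc) .core)).obj X₀ = X₀ := by
    rw [DiagramOfCategories.pathFunctor_nil]
    rfl
  exact isIso_map_app_congr _ (L.iota v ε) h0 (isIso_map_congr hr _ h4)

/-- The same for the `ℤ`-action clause of Cor 5.5 (v) (F-0157), through abc-iut-w5-d112's `cor55ShiftAction_iff`.
[cite: MochizukiAbsTopIII2015, Cor 5.5 (v) p. 132] -/
theorem isIso_toE_forget_iota_of_cor55ShiftAction (hL : L.Cor55ShiftAction) (v : Vmod) {ν₁ ν₂ : LogVertex (isArc v)}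
    (ε : LogEdge (isArc v) ν₁ ν₂) (h₁ : ν₁.isPostLog = false) (h₂ : ν₂.isPostLog = false) (X₀ : L.X) :
    IsIso ((L.toE v).map ((L.forget v).map ((L.iota v ε).app X₀))) := by
  obtain ⟨K, hK, -⟩ := L.cor55ShiftAction_iff.mp hL
  exact L.isIso_toE_forget_iota_of_realisesCor55Families hK v ε h₁ h₂ X₀

/-! ## Refutation over NONEMPTY index sets: the zero-twisted diagonal setting -/

variable (Vmod isArc)

/-- **At the ZERO-TWISTED diagonal setting no family realises Cor 5.5 (i)/(iii).**  For a preadditive large category `C`, an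
object `x₀` with `𝟙 x₀ ≠ 0` and an element `v₀` of the index set: the setting with all rows `C`, all structure functors `𝟭 C`,
all 2-cells identities and every `ι⊞_{v,ε} := 0` (abc-iut-w4-d095's zero-twisted witness) admits NO `K` with
`RealisesCor55Families K` (the pre-log `ι⊞_{v₀,ε}` would be invertible over `ℰ•`, but it is `0` at `x₀`); hence
`Cor55ShiftAction` (F-0157) and `Cor55Rigidity` (F-0156) fail there.  DEGENERATE calibration setting (no arithmetic content).
[cite: MochizukiAbsTopIII2015, Cor 5.5 (v) p. 132] -/
theorem exists_forall_not_realisesCor55Families_of_preadditive (C : Type (u + 1)) [Category.{u} C] [Preadditive C]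
    (x₀ : C) (hx₀ : (𝟙 x₀ : x₀ ⟶ x₀) ≠ 0) (v₀ : Vmod) :
    ∃ L : LogFrobeniusSetting Vmod isArc, L.X = C ∧ (∀ K : L.diagram.HomotopyFamily, ¬ L.RealisesCor55Families K) ∧
      ¬ L.Cor55ShiftAction ∧ ¬ L.Cor55Rigidity := by
  let L₀ : LogFrobeniusSetting Vmod isArc :=
    { X := C
      E := C
      proj := 𝟭 C
      log := 𝟭 C
      logIsoId := Iso.refl _
      logOver := Iso.refl _
      Nplus := fun _ => C
      N := fun _ => C
      forget := fun _ => 𝟭 C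
      toE := fun _ => 𝟭 C
      lam := fun _ _ => 𝟭 C
      lamOver := fun _ _ => Iso.refl _
      lam_spaceLink_eq_postLog := fun _ => rfl
      iota := fun _ _ _ _ => 0
      An := C
      κAn := CategoryTheory.Equivalence.refl
      φAn := 𝟭 C
      φAn_isEquivalence := inferInstance
      ηAn := Iso.refl _
      κAn₂ := CategoryTheory.Equivalence.refl
      Emono := C
      monoAn := 𝟭 C
      NmonoPlus := fun _ => C
      Nmono := fun _ => C
      forgetMono := fun _ => 𝟭 C
      toEmono := fun _ => 𝟭 C
      monoNplus := fun _ => 𝟭 C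
      monoN := fun _ => 𝟭 C
      monoHomotopy := fun _ => Iso.refl _
      AnMono := C
      κAnMono := CategoryTheory.Equivalence.refl
      ψAnMono := fun _ _ => 𝟭 C }
  have hK : ∀ K : L₀.diagram.HomotopyFamily, ¬ L₀.RealisesCor55Families K := by
    intro K hK
    obtain ⟨ν₁, ν₂, ε, h₁, h₂⟩ := LogVertex.exists_preLog_edge (isArc v₀)
    have hiso := L₀.isIso_toE_forget_iota_of_realisesCor55Families hK v₀ ε h₁ h₂ x₀
    change IsIso ((0 : (frobeniusTwist L₀.log ν₁.isPostLog ⋙ L₀.lam v₀ ν₁) ⟶ L₀.lam v₀ ν₂).app x₀) at hiso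
    rw [NatTrans.app_zero] at hiso
    refine hx₀ ?_
    change 𝟙 ((L₀.lam v₀ ν₂).obj x₀) = 0
    rw [← IsIso.inv_hom_id (0 : (frobeniusTwist L₀.log ν₁.isPostLog ⋙ L₀.lam v₀ ν₁).obj x₀ ⟶ (L₀.lam v₀ ν₂).obj x₀),
      Limits.comp_zero]
  have hS : ¬ L₀.Cor55ShiftAction := fun h => by
    obtain ⟨K, hK', -⟩ := L₀.cor55ShiftAction_iff.mp h
    exact hK K hK'
  exact ⟨L₀, rfl, hK, hS, fun h => hS h.2⟩

/-- **F-0159 / F-0157 / F-0156 fail at some setting over EVERY index set with an element** (e.g. a number field's `V(F_mod)`):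
the zero-twisted diagonal setting on the category of abelian groups `AddCommGrpCat.{u}` (`𝟙_ℤ ≠ 0`).  Together with
`LogFrobeniusShiftActionNecessity.lean` (empty index sets) and the diagonal instance (sequel file: the rows HOLD at the
plain diagonal setting): the three rows are conditions on the setting, INDEPENDENT of the interface `LogFrobeniusSetting`;
R5 — consumable at named instances only.  DEGENERATE calibration witness. [cite: MochizukiAbsTopIII2015, Cor 5.5 (v) p. 132] -/
theorem exists_forall_not_realisesCor55Families (v₀ : Vmod) :
    ∃ L : LogFrobeniusSetting Vmod isArc, (∀ K : L.diagram.HomotopyFamily, ¬ L.RealisesCor55Families K) ∧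
      ¬ L.Cor55ShiftAction ∧ ¬ L.Cor55Rigidity := by
  have hx₀ : (𝟙 (AddCommGrpCat.of (ULift.{u} ℤ)) : _ ⟶ _) ≠ 0 := by
    intro h
    have h1 := congrArg (fun f : AddCommGrpCat.of (ULift.{u} ℤ) ⟶ AddCommGrpCat.of (ULift.{u} ℤ) =>
      (f.hom (ULift.up 1)).down) h
    simp at h1
  obtain ⟨L, -, hL⟩ :=
    exists_forall_not_realisesCor55Families_of_preadditive Vmod isArc AddCommGrpCat.{u} _ hx₀ v₀
  exact ⟨L, hL⟩

/-- In particular, over every NONEMPTY index set some setting violates the typed Cor 5.5 (v), third clause (F-0157) — the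
universal closure of F-0157 is refuted WITHOUT resorting to the empty index set. [cite: MochizukiAbsTopIII2015, Cor 5.5 (v) p. 132] -/
theorem exists_not_cor55ShiftAction (v₀ : Vmod) : ∃ L : LogFrobeniusSetting Vmod isArc, ¬ L.Cor55ShiftAction := by
  obtain ⟨L, -, hL, -⟩ := exists_forall_not_realisesCor55Families Vmod isArc v₀
  exact ⟨L, hL⟩

end LogFrobeniusSetting

end Literature.AnabelianGeometry.AbsoluteAnabelian
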